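import Mathlib
import HarnessLib
import Summits.NavierStokesRegularity.NavierStokesRegularity.Theorems.HalfSpaceWindowDoorCirculationCarryingRigidityPlanarEnergy
import Summits.NavierStokesRegularity.NavierStokesRegularity.Theorems.HalfSpaceWindowDoorCirculationCarryingRigidityWindowedFlux

/-!
# Route `HalfSpaceWindowDoor`, crux `CirculationCarryingRigidity` (stmt-NavierStokesRegularity-25311) — line `ledger`, Step 1:
# the LOGARITHMIC ENERGY COST of circulation (kinematics of one closed-hemisphere slice)

LEAD ns-hsw-p1 g12 (cell pub-ns-dss), `--supports stmt-NavierStokesRegularity-25311 --as helper`.  Companion of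
`…CirculationCarryingRigidityLedger` (Step 2: the far-past energy ledger of the door class ⇒ tube pinching ⇒ «no columnar
vortex»).  This file is pure slice kinematics (no dynamics, no class): a `C¹` field `v(s)` on `ℝ³` with `ω₃ = ⟪curl v(s), e₃⟫ ≥ 0`.

THE MECHANISM (point-vortex energy is logarithmically divergent).  With `ω₃ ≥ 0` the disc circulation
`Γ(r,c,s) = ∮_{S(r,c)} v·e_θ dl` about the vertical axis is non-negative and non-decreasing in `r` (`circ_nonneg`, `circ_mono`),
and on every circle `r∫₀^{2π}‖v(s)(r,θ,c)‖²dθ ≥ Γ(r,c,s)²/(2πr)` (`…PlanarEnergy.radial_energy_ge`).  Hence: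

* `annulusEnergy_ge` — ONE PLANE: `Γ(ρ,c,s)² · log(R/ρ)/(2π) ≤ ∫_{ρ<|ξ|<R} ‖v(s)(ξ,c)‖² dξ` (`0 < ρ < R`; planar polar
  coordinates `Literature…PlanarPolarCoords.integral_eq_integral_circlePt` on the truncated density);
* `integral_circ_sq_mul_log_le_ball` — A STACK OF PLANES: `(∫_{(z₀−R,z₀+R)} Γ(ρ,c,s)² dc) · log(R/ρ)/(2π) ≤ ∫_{B((0,0,z₀),2R)} ‖v(s)‖²`
  (the cylinder `{ρ<|ξ|<R} × (z₀−R, z₀+R)` lies in the ball; Fubini along the volume-preserving slicing `ℝ × ℝ² ≃ ℝ³`,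
  `(c, ξ) ↦ planePt c ξ`, as in `…PlanarEnergy.ae_integrable_planar_sq`);
* `circ_sq_integral_mul_log_le` — **RMS CIRCULATION LAW for one slice under a Leray-rate energy ledger**
  `∫_{B_r(x₀)}‖v(s)‖² ≤ K r` (all `x₀`, `r`): `(∫_{(z₀−R,z₀+R)} Γ(ρ,c,s)² dc) · log(R/ρ) ≤ 4πKR`;
* `mul_le_integral_circ_sq` — bookkeeping: `Γ ≥ γ ≥ 0` on a height window of length `ℓ` gives `∫ Γ² ≥ γ²ℓ`.

WHAT THIS IS NOT: not a statement about Navier–Stokes regularity (Clay A); door statements are regularity CRITERIA about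
HYPOTHETICAL blow-up profiles (KNSS ancient mild solutions); item 25311 stays OPEN at its research stub `stub_layerExclusion`.
-/

noncomputable section

-- the summit and its single sub-problem share the name (CONVENTIONS §1), as in every Theorems file
set_option linter.dupNamespace false

namespace Summit.NavierStokesRegularity.NavierStokesRegularity.Theorems.HalfSpaceWindowDoorCirculationCarryingRigidityLogEnergy

open Set Function Filter MeasureTheory Topology intervalIntegral Metric
open scoped InnerProductSpace RealInnerProductSpace
open Literature.Analysis Literature.Analysis.FluidPDE
open Summit.NavierStokesRegularity.NavierStokesRegularity.Theorems.HalfSpaceWindowDoorCirculationCarryingRigidityDefs (planePt)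
open Summit.NavierStokesRegularity.NavierStokesRegularity.Theorems.AxisTwistDoorAveragedConeLiouvilleDefs (cylPt eT circ SignE3)
open Summit.NavierStokesRegularity.NavierStokesRegularity.Theorems.AveragedConeLiouville.CircMonotone (circ_nonneg circ_mono)
open Summit.NavierStokesRegularity.NavierStokesRegularity.Theorems.HalfSpaceWindowDoorCirculationCarryingRigidityPlanarEnergy
  (planePt_circlePt periodic_normSq_cylPt radial_energy_ge continuous_circ_height)
open Summit.NavierStokesRegularity.NavierStokesRegularity.Theorems.HalfSpaceWindowDoorCirculationCarryingRigidityWindowedFlux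
  (continuous_planePt)

variable {v : ℝ → EuclideanSpace ℝ (Fin 3) → EuclideanSpace ℝ (Fin 3)}

/-! ### Geometry of the plane chart -/

/-- `‖(ξ₀, ξ₁, a)‖² = ‖ξ‖² + a²`. -/
theorem norm_planePt_sq (a : ℝ) (ξ : EuclideanSpace ℝ (Fin 2)) : ‖planePt a ξ‖ ^ 2 = ‖ξ‖ ^ 2 + a ^ 2 := by
  rw [EuclideanSpace.norm_sq_eq, EuclideanSpace.norm_sq_eq]
  simp only [Fin.sum_univ_two, Fin.sum_univ_three, Real.norm_eq_abs, sq_abs, planePt]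
  simp

/-- `planePt c ξ − planePt z₀ 0 = planePt (c − z₀) ξ`. -/
theorem planePt_sub_planePt_zero (c z₀ : ℝ) (ξ : EuclideanSpace ℝ (Fin 2)) :
    planePt c ξ - planePt z₀ 0 = planePt (c - z₀) ξ := by
  ext i
  fin_cases i <;> simp [planePt]

/-- A point of the cylinder `{|ξ| < R} × (z₀ − R, z₀ + R)` lies in the ball `B((0,0,z₀), 2R)`. -/
theorem planePt_mem_ball {c z₀ R : ℝ} {ξ : EuclideanSpace ℝ (Fin 2)} (hξ : ‖ξ‖ < R) (hc : c ∈ Ioo (z₀ - R) (z₀ + R)) :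
    planePt c ξ ∈ ball (planePt z₀ 0) (2 * R) := by
  rw [mem_ball, dist_eq_norm, planePt_sub_planePt_zero]
  have hR : 0 < R := (norm_nonneg ξ).trans_lt hξ
  have hcz : |c - z₀| < R := abs_lt.2 ⟨by linarith [hc.1], by linarith [hc.2]⟩
  have hsq : ‖planePt (c - z₀) ξ‖ ^ 2 < (2 * R) ^ 2 := by
    rw [norm_planePt_sq]
    have h1 : ‖ξ‖ ^ 2 < R ^ 2 := pow_lt_pow_left₀ hξ (norm_nonneg _) two_ne_zero
    have h2 : (c - z₀) ^ 2 < R ^ 2 := by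
      rw [← sq_abs]; exact pow_lt_pow_left₀ hcz (abs_nonneg _) two_ne_zero
    nlinarith
  exact lt_of_pow_lt_pow_left₀ 2 (by positivity) hsq

/-! ### §1  One plane: the annular energy controls the circulation logarithmically -/

/-- The open planar annulus `{ρ < |ξ| < R}` is open. -/
theorem isOpen_annulus (ρ R : ℝ) : IsOpen {ξ : EuclideanSpace ℝ (Fin 2) | ρ < ‖ξ‖ ∧ ‖ξ‖ < R} :=
  (isOpen_Ioo.preimage continuous_norm : IsOpen ((fun ξ : EuclideanSpace ℝ (Fin 2) => ‖ξ‖) ⁻¹' Ioo ρ R))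

/-- … and measurable. -/
theorem measurableSet_annulus (ρ R : ℝ) : MeasurableSet {ξ : EuclideanSpace ℝ (Fin 2) | ρ < ‖ξ‖ ∧ ‖ξ‖ < R} :=
  (isOpen_annulus ρ R).measurableSet

/-- … and bounded: it lies in the closed disc of radius `R`. -/
theorem annulus_subset_closedBall (ρ R : ℝ) :
    {ξ : EuclideanSpace ℝ (Fin 2) | ρ < ‖ξ‖ ∧ ‖ξ‖ < R} ⊆ closedBall (0 : EuclideanSpace ℝ (Fin 2)) R :=
  fun ξ hξ => by simpa [mem_closedBall, dist_zero_right] using hξ.2.le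

/-- The planar energy density of a continuous slice is integrable on the annulus. -/
theorem integrableOn_annulus {s c ρ R : ℝ} (hv : Continuous (v s)) :
    IntegrableOn (fun ξ : EuclideanSpace ℝ (Fin 2) => ‖v s (planePt c ξ)‖ ^ 2) {ξ : EuclideanSpace ℝ (Fin 2) | ρ < ‖ξ‖ ∧ ‖ξ‖ < R} :=
  (((hv.comp (continuous_planePt c)).norm.pow 2).continuousOn.integrableOn_compact
    (isCompact_closedBall _ _)).mono_set (annulus_subset_closedBall ρ R)

/-- The circle of radius `r ∈ (ρ, R)` lies in the annulus `{ρ < |ξ| < R}`. -/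
theorem circlePt_mem_annulus {ρ R r : ℝ} (hr : r ∈ Ioo ρ R) (hρ : 0 ≤ ρ) (θ : ℝ) :
    circlePt r θ ∈ {ξ : EuclideanSpace ℝ (Fin 2) | ρ < ‖ξ‖ ∧ ‖ξ‖ < R} := by
  have hr0 : 0 ≤ r := hρ.trans hr.1.le
  simp only [mem_setOf_eq, norm_circlePt, abs_of_nonneg hr0]
  exact hr

/-- The angular integral over `(-π, π]` equals the one over `[0, 2π]` (periodicity). -/
theorem setIntegral_Ioc_eq_intervalIntegral (s c r : ℝ) :
    ∫ θ in Ioc (-Real.pi) Real.pi, ‖v s (cylPt r θ c)‖ ^ 2 = ∫ θ in (0 : ℝ)..(2 * Real.pi), ‖v s (cylPt r θ c)‖ ^ 2 := by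
  rw [← intervalIntegral.integral_of_le (by linarith [Real.pi_pos] : -Real.pi ≤ Real.pi)]
  have hper := (periodic_normSq_cylPt (v := v) s c r).intervalIntegral_add_eq (-Real.pi) 0
  simp only [zero_add] at hper
  rw [← hper]
  congr 1
  ring

/-- **THE ONE-PLANE LOG BOUND.**  For a `C¹` slice with `ω₃ ≥ 0`, `0 < ρ < R`, on the plane `{x₃ = c}`:
`Γ(ρ,c,s)² · log(R/ρ) / (2π) ≤ ∫_{ρ<|ξ|<R} ‖v(s)(ξ,c)‖² dξ` — the point-vortex energy of the circulation already present at radius `ρ`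
is paid logarithmically by every larger annulus (`Γ` is non-decreasing in the radius). -/
theorem annulusEnergy_ge {s c ρ R : ℝ} (hs : s < 0) (hv1 : ContDiff ℝ 1 (v s)) (hsign : SignE3 v)
    (hρ : 0 < ρ) (hρR : ρ < R) :
    circ v ρ c s ^ 2 / (2 * Real.pi) * Real.log (R / ρ) ≤
      ∫ ξ in {ξ : EuclideanSpace ℝ (Fin 2) | ρ < ‖ξ‖ ∧ ‖ξ‖ < R}, ‖v s (planePt c ξ)‖ ^ 2 := by
  have hvc : Continuous (v s) := hv1.continuous
  have hR : 0 < R := hρ.trans hρR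
  set A : Set (EuclideanSpace ℝ (Fin 2)) := {ξ | ρ < ‖ξ‖ ∧ ‖ξ‖ < R} with hA
  set γ : ℝ := circ v ρ c s with hγ
  have hγ0 : 0 ≤ γ := circ_nonneg v hv1 hsign hs hρ.le c
  -- the truncated planar density
  set g : EuclideanSpace ℝ (Fin 2) → ℝ := A.indicator fun ξ => ‖v s (planePt c ξ)‖ ^ 2 with hg
  have hgi : Integrable g := (integrable_indicator_iff (measurableSet_annulus ρ R)).2 (integrableOn_annulus hvc)
  have hg_nonneg : ∀ ξ, 0 ≤ g ξ := fun ξ => by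
    simp only [hg]
    exact Set.indicator_nonneg (fun _ _ => by positivity) _
  -- polar coordinates
  have hpolar : ∫ ξ in A, ‖v s (planePt c ξ)‖ ^ 2 =
      ∫ r in Ioi (0 : ℝ), ∫ θ in Ioc (-Real.pi) Real.pi, r • g (circlePt r θ) := by
    rw [← MeasureTheory.integral_indicator (measurableSet_annulus ρ R)]
    exact integral_eq_integral_circlePt hgi
  rw [hpolar]
  -- the radial lower bound `h ≤ inner integral` on `(0, ∞)`
  set h : ℝ → ℝ := (Ioo ρ R).indicator fun r => γ ^ 2 / (2 * Real.pi * r) with hh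
  have hinner : ∀ r ∈ Ioi (0 : ℝ), h r ≤ ∫ θ in Ioc (-Real.pi) Real.pi, r • g (circlePt r θ) := by
    intro r hr0
    have hr0' : 0 < r := hr0
    by_cases hr : r ∈ Ioo ρ R
    · -- on the annulus the truncation is invisible
      have hgr : ∀ θ : ℝ, r • g (circlePt r θ) = r * ‖v s (cylPt r θ c)‖ ^ 2 := by
        intro θ
        have hmem : circlePt r θ ∈ A := circlePt_mem_annulus hr hρ.le θ
        rw [smul_eq_mul, hg, Set.indicator_of_mem hmem, planePt_circlePt]
      simp_rw [hgr]
      rw [MeasureTheory.integral_const_mul, setIntegral_Ioc_eq_intervalIntegral, hh, Set.indicator_of_mem hr]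
      rcases hγ0.eq_or_lt with hγz | hγpos
      · rw [← hγz]
        simp only [ne_eq, OfNat.ofNat_ne_zero, not_false_eq_true, zero_pow, zero_div]
        exact mul_nonneg hr0'.le (intervalIntegral.integral_nonneg (by positivity) fun θ _ => by positivity)
      · exact radial_energy_ge hr0' hγpos hvc (circ_mono v hv1 hsign hs hρ.le hr.1.le c)
    · rw [hh, Set.indicator_of_notMem hr]
      exact setIntegral_nonneg measurableSet_Ioc fun θ _ => by
        rw [smul_eq_mul]; exact mul_nonneg hr0'.le (hg_nonneg _)
  -- integrability of both sides on `(0, ∞)`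
  have houter : IntegrableOn (fun r : ℝ => ∫ θ in Ioc (-Real.pi) Real.pi, r • g (circlePt r θ)) (Ioi 0) := by
    have := (integrable_circlePt_smul hgi).integral_prod_left
    simpa [IntegrableOn] using this
  have hhint : IntegrableOn h (Ioi 0) := by
    have hcont : ContinuousOn (fun r : ℝ => γ ^ 2 / (2 * Real.pi * r)) (Icc ρ R) := by
      refine continuousOn_const.div (continuousOn_const.mul continuousOn_id) fun r hr => ?_
      have : 0 < r := hρ.trans_le hr.1
      positivity
    have hIoo : IntegrableOn (fun r : ℝ => γ ^ 2 / (2 * Real.pi * r)) (Ioo ρ R) :=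
      (hcont.integrableOn_compact isCompact_Icc).mono_set Ioo_subset_Icc_self
    rw [hh, IntegrableOn, integrable_indicator_iff measurableSet_Ioo]
    exact hIoo.restrict
  -- compare
  have hmono : ∫ r in Ioi (0 : ℝ), h r ≤ ∫ r in Ioi (0 : ℝ), ∫ θ in Ioc (-Real.pi) Real.pi, r • g (circlePt r θ) :=
    setIntegral_mono_on hhint houter measurableSet_Ioi hinner
  refine le_trans (le_of_eq ?_) hmono
  -- `∫_{(0,∞)} h = γ²/(2π) · log(R/ρ)`
  rw [hh, setIntegral_indicator measurableSet_Ioo,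
    show Ioi (0 : ℝ) ∩ Ioo ρ R = Ioo ρ R from
      inter_eq_right.2 fun r hr => (hρ.trans hr.1 : (0 : ℝ) < r),
    ← integral_Ioc_eq_integral_Ioo, ← intervalIntegral.integral_of_le hρR.le]
  have hfun : (fun r : ℝ => γ ^ 2 / (2 * Real.pi * r)) = fun r => γ ^ 2 / (2 * Real.pi) * r⁻¹ := by
    funext r
    rw [div_mul_eq_div_div, div_eq_mul_inv]
  rw [hfun, intervalIntegral.integral_const_mul, integral_inv_of_pos hρ hR]

/-! ### §2  Stacking the planes: the cylinder lies in a ball -/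

/-- **STACKING.**  For a `C¹` slice with `ω₃ ≥ 0` and `0 < ρ < R`:
`(∫_{(z₀−R, z₀+R)} Γ(ρ,c,s)² dc) · log(R/ρ)/(2π) ≤ ∫_{B((0,0,z₀), 2R)} ‖v(s)‖²`
(Fubini along the volume-preserving slicing `ℝ × ℝ² ≃ ℝ³`, `(c, ξ) ↦ planePt c ξ`, the one-plane log bound on each plane of the
stack, and the inclusion of the cylinder `{ρ<|ξ|<R} × (z₀−R, z₀+R)` in the ball). -/
theorem integral_circ_sq_mul_log_le_ball {s z₀ ρ R : ℝ} (hs : s < 0) (hv1 : ContDiff ℝ 1 (v s)) (hsign : SignE3 v)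
    (hρ : 0 < ρ) (hρR : ρ < R) :
    (∫ c in Ioo (z₀ - R) (z₀ + R), circ v ρ c s ^ 2) * (Real.log (R / ρ) / (2 * Real.pi)) ≤
      ∫ x in ball (planePt z₀ 0) (2 * R), ‖v s x‖ ^ 2 := by
  have hvc : Continuous (v s) := hv1.continuous
  set I : Set ℝ := Ioo (z₀ - R) (z₀ + R) with hI
  set A : Set (EuclideanSpace ℝ (Fin 2)) := {ξ | ρ < ‖ξ‖ ∧ ‖ξ‖ < R} with hA
  set B : Set (EuclideanSpace ℝ (Fin 3)) := ball (planePt z₀ 0) (2 * R) with hB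
  have hIm : MeasurableSet I := measurableSet_Ioo
  have hAm : MeasurableSet A := measurableSet_annulus ρ R
  have hBm : MeasurableSet B := measurableSet_ball
  -- the truncated density on `ℝ³`
  set F : EuclideanSpace ℝ (Fin 3) → ℝ := B.indicator fun x => ‖v s x‖ ^ 2 with hF
  have hFi : Integrable F := (integrable_indicator_iff hBm).2
    ((((hvc.norm.pow 2).continuousOn.integrableOn_compact (isCompact_closedBall _ _)).mono_set ball_subset_closedBall))
  have hF_nonneg : ∀ x, 0 ≤ F x := fun x => Set.indicator_nonneg (fun _ _ => by positivity) _
  -- the slicing equivalence `ℝ × ℝ² ≃ᵐ ℝ³`, `(c, ξ) ↦ planePt c ξ` (as in `…PlanarEnergy.ae_integrable_planar_sq`)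
  set T : ℝ × EuclideanSpace ℝ (Fin 2) ≃ᵐ EuclideanSpace ℝ (Fin 3) :=
    ((MeasurableEquiv.prodCongr (MeasurableEquiv.refl ℝ) (MeasurableEquiv.toLp 2 (Fin 2 → ℝ)).symm).trans
      (MeasurableEquiv.piFinSuccAbove (fun _ => ℝ) 2).symm).trans (MeasurableEquiv.toLp 2 (Fin 3 → ℝ)) with hT
  have hTmp : MeasurePreserving T (volume.prod volume) volume := by
    refine (MeasurePreserving.trans ?_ (volume_preserving_piFinSuccAbove (fun _ => ℝ) 2).symm).trans
      (PiLp.volume_preserving_toLp (Fin 3))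
    have h2 : MeasurePreserving (MeasurableEquiv.toLp 2 (Fin 2 → ℝ)).symm volume volume :=
      EuclideanSpace.volume_preserving_symm_measurableEquiv_toLp (Fin 2)
    exact (MeasurePreserving.id volume).prod h2
  have hTapply : ∀ c : ℝ, ∀ ξ : EuclideanSpace ℝ (Fin 2), T (c, ξ) = planePt c ξ := by
    intro c ξ
    ext i
    fin_cases i <;> rfl
  -- the truncated density on the product, `G ≤ F ∘ T`
  set f : ℝ × EuclideanSpace ℝ (Fin 2) → ℝ := fun p => ‖v s (planePt p.1 p.2)‖ ^ 2 with hf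
  set G : ℝ × EuclideanSpace ℝ (Fin 2) → ℝ := (I ×ˢ A).indicator f with hG
  have hFT : Integrable (fun p => F (T p)) (volume.prod volume) :=
    (hTmp.integrable_comp_emb T.measurableEmbedding).2 hFi
  have hGeq : G = (I ×ˢ A).indicator fun p => F (T p) := by
    funext p
    by_cases hp : p ∈ I ×ˢ A
    · have hmem : planePt p.1 p.2 ∈ B := planePt_mem_ball hp.2.2 hp.1
      rw [hG, Set.indicator_of_mem hp, Set.indicator_of_mem hp]
      change f p = F (T (p.1, p.2))
      rw [hTapply, hF, Set.indicator_of_mem hmem]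
    · rw [hG, Set.indicator_of_notMem hp, Set.indicator_of_notMem hp]
  have hGi : Integrable G (volume.prod volume) := by
    rw [hGeq]; exact hFT.indicator (hIm.prod hAm)
  have hGle : ∀ p, G p ≤ F (T p) := by
    intro p
    rw [hGeq]
    by_cases hp : p ∈ I ×ˢ A
    · rw [Set.indicator_of_mem hp]
    · rw [Set.indicator_of_notMem hp]; exact hF_nonneg _
  -- `∫ G ≤ ∫ F∘T = ∫ F = ∫_B ‖v‖²`
  have h1 : ∫ p, G p ∂(volume.prod volume) ≤ ∫ x in B, ‖v s x‖ ^ 2 := by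
    calc ∫ p, G p ∂(volume.prod volume)
        ≤ ∫ p, F (T p) ∂(volume.prod volume) := integral_mono hGi hFT hGle
      _ = ∫ x, F x := hTmp.integral_comp' F
      _ = ∫ x in B, ‖v s x‖ ^ 2 := MeasureTheory.integral_indicator hBm
  -- the `c`-slices of `G`
  set h : ℝ → ℝ := fun c => ∫ ξ in A, ‖v s (planePt c ξ)‖ ^ 2 with hh
  have hslice : (fun c => ∫ ξ, G (c, ξ)) = I.indicator h := by
    funext c
    by_cases hc : c ∈ I
    · rw [Set.indicator_of_mem hc, hh]
      have hGc : (fun ξ => G (c, ξ)) = A.indicator fun ξ => ‖v s (planePt c ξ)‖ ^ 2 := by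
        funext ξ
        by_cases hξ : ξ ∈ A
        · rw [hG, Set.indicator_of_mem (mk_mem_prod hc hξ), Set.indicator_of_mem hξ]
        · have : (c, ξ) ∉ I ×ˢ A := fun hp => hξ hp.2
          rw [hG, Set.indicator_of_notMem this, Set.indicator_of_notMem hξ]
      change ∫ ξ, (fun ξ => G (c, ξ)) ξ = _
      rw [hGc, MeasureTheory.integral_indicator hAm]
    · rw [Set.indicator_of_notMem hc]
      have hGc : (fun ξ => G (c, ξ)) = fun _ => 0 := by
        funext ξ
        have : (c, ξ) ∉ I ×ˢ A := fun hp => hc hp.1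
        rw [hG, Set.indicator_of_notMem this]
      change ∫ ξ, (fun ξ => G (c, ξ)) ξ = 0
      rw [hGc, integral_zero]
  have h2 : ∫ p, G p ∂(volume.prod volume) = ∫ c in I, h c := by
    rw [integral_prod _ hGi, hslice, MeasureTheory.integral_indicator hIm]
  have hhI : IntegrableOn h I := by
    have := hGi.integral_prod_left
    rw [hslice] at this
    exact (integrable_indicator_iff hIm).1 this
  -- the one-plane bound on each plane of the stack
  have h3 : ∫ c in I, circ v ρ c s ^ 2 * (Real.log (R / ρ) / (2 * Real.pi)) ≤ ∫ c in I, h c := by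
    refine setIntegral_mono_on ?_ hhI hIm fun c _ => ?_
    · exact ((((continuous_circ_height hvc ρ).pow 2).mul continuous_const).continuousOn.integrableOn_compact
        isCompact_Icc).mono_set Ioo_subset_Icc_self
    · have key := annulusEnergy_ge (c := c) hs hv1 hsign hρ hρR
      rw [hh]
      calc circ v ρ c s ^ 2 * (Real.log (R / ρ) / (2 * Real.pi))
          = circ v ρ c s ^ 2 / (2 * Real.pi) * Real.log (R / ρ) := by ring
        _ ≤ ∫ ξ in A, ‖v s (planePt c ξ)‖ ^ 2 := key
  rw [MeasureTheory.integral_mul_const] at h3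
  exact h3.trans (h2 ▸ h1)

/-! ### §3  The RMS circulation law of one slice under a Leray-rate energy ledger -/

/-- **RMS CIRCULATION LAW (one slice).**  For a `C¹` slice with `ω₃ ≥ 0` whose kinetic energy obeys the Leray-rate ledger
`∫_{B_r(x₀)} ‖v(s)‖² ≤ K r` (all centres, all radii) — e.g. any slice of a door-class profile (`exists_ledger`) —, for all
`0 < ρ < R` and `z₀`:  `(∫_{(z₀−R, z₀+R)} Γ(ρ,c,s)² dc) · log(R/ρ) ≤ 4π K R`. -/
theorem circ_sq_integral_mul_log_le {s : ℝ} (hs : s < 0) (hv1 : ContDiff ℝ 1 (v s)) (hsign : SignE3 v) {K : ℝ}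
    (hK : ∀ (x₀ : EuclideanSpace ℝ (Fin 3)) (r : ℝ), 0 < r → ∫ x in ball x₀ r, ‖v s x‖ ^ 2 ≤ K * r)
    {ρ R : ℝ} (hρ : 0 < ρ) (hρR : ρ < R) (z₀ : ℝ) :
    (∫ c in Ioo (z₀ - R) (z₀ + R), circ v ρ c s ^ 2) * Real.log (R / ρ) ≤ 4 * Real.pi * K * R := by
  have hR : 0 < R := hρ.trans hρR
  have h1 := integral_circ_sq_mul_log_le_ball (z₀ := z₀) hs hv1 hsign hρ hρR
  have h2 := hK (planePt z₀ 0) (2 * R) (by positivity)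
  have h3 := h1.trans h2
  have hπ : 0 < 2 * Real.pi := by positivity
  rw [← mul_div_assoc, div_le_iff₀ hπ] at h3
  linarith

/-- The height integral of `Γ²` over a window on which `Γ ≥ γ` is at least `γ² · (length)`. -/
theorem mul_le_integral_circ_sq {s ρ γ a b : ℝ} (hvc : Continuous (v s)) (hab : a ≤ b) (hγ : 0 ≤ γ)
    (hge : ∀ c ∈ Ioo a b, γ ≤ circ v ρ c s) :
    γ ^ 2 * (b - a) ≤ ∫ c in Ioo a b, circ v ρ c s ^ 2 := by
  have hconst : ∫ _ in Ioo a b, γ ^ 2 = γ ^ 2 * (b - a) := by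
    rw [setIntegral_const, smul_eq_mul, Real.volume_real_Ioo_of_le hab, mul_comm]
  rw [← hconst]
  refine setIntegral_mono_on (integrableOn_const (by rw [Real.volume_Ioo]; exact ENNReal.ofReal_lt_top.ne)) ?_
    measurableSet_Ioo fun c hc => ?_
  · exact (((continuous_circ_height hvc ρ).pow 2).continuousOn.integrableOn_compact isCompact_Icc).mono_set
      Ioo_subset_Icc_self
  · exact pow_le_pow_left₀ hγ (hge c hc) 2

end Summit.NavierStokesRegularity.NavierStokesRegularity.Theorems.HalfSpaceWindowDoorCirculationCarryingRigidityLogEnergy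

end
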